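import Summits.ValiantsHypothesis.ValiantsHypothesis.Theorems.EquivariantDialLayersApolarForms
import HarnessLib

/-!
# The apolar bridge: coefficient pairing, transposed substitution, transfer to an isotypic projector

Support for the census cell W36 (leaf `R^lay = IdealWidthSuperpoly biPermSubst`) only; `IdealWidthSuperpoly`,
`EqHardLayered biPermSubst` (`A^lay`), `EqHardBiPerm` (cell A), stmt-ValiantsHypothesis-23702 and `VP ≠ VNP` are untouched
and proved by nothing here; mechanism KNOWN (coefficient/apolarity pairing = transpose of a monomial substitution; isotypic
projectors, Serre §2.6 Thm 8; Pieri–Young depth window); inside the catalogued equivariance barrier (Landsberg–Ressayre 2017,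
Dawar–Wilsenach 2020). Lane `--supports`: nothing here closes a route item. File R3 of the «block-witness apolar bound»
programme: the bridge from «`∑_t χ(t) t⁻¹·f ∉ Φ⁻¹((z_k²)_k)`», `Φ = Φ_{κ,w} = aeval (x ↦ C (w x) · X (κ x))` a weighted
relabelling (`blockSubst` is one, §3), to «`P_χ u ≠ 0`» for `u = u_{μ'} = ∏_{k ∈ μ'}` (fibre form `∑_{κ x = k} w x · X x`).
* §1 the coefficient pairing `cpair f g = ∑_α coeff_α f · coeff_α g` (the one data definition): bilinearity, invariance
  under a simultaneous `rename e`, adjoint form `cpair (e⁻¹·f) g = cpair f (e·g)`;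
* §2 CLOSED FORM of the coefficients of a product of distinct fibre forms; ★ BRIDGE `coeff_{𝟙_{μ'}} (Φ f) = cpair f u_{μ'}`;
  ★ EXISTENCE `f ∉ Φ⁻¹((z_k²)_k) ⇒ ∃ μ', cpair f u_{μ'} ≠ 0`, with `#μ' = deg f` for homogeneous `f`;
* §3 `blockSubst e ε δ = Φ_{κ,w}` (`rfl`); its fibre forms are the rank-one forms `ℓ(v_r, w_c)` of `…ApolarForms`;
* §4 ADJOINTNESS of weighted symmetrisers of `𝔖_m × 𝔖_m`; the representation on a stable submodule (`…QuadricTypes` §4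
  inline construction, packaged); ★★ TRANSFER `cpair (∑_t χ(t) t⁻¹·f) u ≠ 0 → P_χ u ≠ 0` (`χ(t⁻¹) = χ(t)`, `χ(1) ≠ 0`).
References: [cite: SerreLinearRepresentations1977, §2.6 Thm. 8]; [cite: BurgisserEtAl2011, Prop. 4.5.4]; all folklore.
-/

set_option linter.dupNamespace false

namespace Summit.ValiantsHypothesis.ValiantsHypothesis.Theorems.EquivariantDialLayersApolarPairing

open MvPolynomial
open Equiv (Perm)
open Literature.RepresentationTheory.FiniteGroups
open Literature.NumberTheory.DiophantineGeometry (spechtCharacter)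
open Summit.ValiantsHypothesis.ValiantsHypothesis.Theorems.EquivariantDialLayersBlockWitness
open Summit.ValiantsHypothesis.ValiantsHypothesis.Theorems.EquivariantDialLayersQuadricTypes

/-! ## §1 The coefficient pairing -/

section Pairing

variable {σ : Type*}

/-- The COEFFICIENT PAIRING `⟨f, g⟩ = ∑_α f_α g_α` (summed over the support of the test vector `g`). -/
noncomputable def cpair (f g : MvPolynomial σ ℂ) : ℂ := ∑ α ∈ g.support, coeff α f * coeff α g

/-- The pairing may be summed over any finite set of exponents containing the support of `f`. [folklore] -/
theorem cpair_eq_sum_of_subset_left {f g : MvPolynomial σ ℂ} {S : Finset (σ →₀ ℕ)} (hf : f.support ⊆ S) :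
    cpair f g = ∑ α ∈ S, coeff α f * coeff α g := by
  classical
  rw [show cpair f g = ∑ α ∈ S ∪ g.support, coeff α f * coeff α g from
    Finset.sum_subset Finset.subset_union_right fun α _ hα => by rw [notMem_support_iff.1 hα, mul_zero]]
  exact (Finset.sum_subset Finset.subset_union_left fun α _ hα => by
    rw [notMem_support_iff.1 fun h => hα (hf h), zero_mul]).symm

/-- Symmetry. [folklore] -/
theorem cpair_comm (f g : MvPolynomial σ ℂ) : cpair f g = cpair g f := by
  rw [cpair_eq_sum_of_subset_left (subset_refl f.support)]
  exact Finset.sum_congr rfl fun α _ => mul_comm _ _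

/-- `⟨f, 0⟩ = 0`. [folklore] -/
theorem cpair_zero_right (f : MvPolynomial σ ℂ) : cpair f 0 = 0 := by simp [cpair]

/-- Homogeneity on the left. [folklore] -/
theorem cpair_smul_left (c : ℂ) (f g : MvPolynomial σ ℂ) : cpair (c • f) g = c * cpair f g := by
  simp only [cpair, coeff_smul, smul_eq_mul, mul_assoc, Finset.mul_sum]

/-- Finite sums on the left. [folklore] -/
theorem cpair_sum_left {ι : Type*} (s : Finset ι) (f : ι → MvPolynomial σ ℂ) (g : MvPolynomial σ ℂ) :
    cpair (∑ i ∈ s, f i) g = ∑ i ∈ s, cpair (f i) g := by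
  simp only [cpair, coeff_sum, Finset.sum_mul]
  exact Finset.sum_comm

/-- Weighted finite sums on the right. [folklore] -/
theorem cpair_sum_smul_right {ι : Type*} (s : Finset ι) (c : ι → ℂ) (f : MvPolynomial σ ℂ)
    (g : ι → MvPolynomial σ ℂ) : cpair f (∑ i ∈ s, c i • g i) = ∑ i ∈ s, c i * cpair f (g i) := by
  rw [cpair_comm, cpair_sum_left]
  exact Finset.sum_congr rfl fun i _ => by rw [cpair_smul_left, cpair_comm]

/-- A non-zero pairing has a common monomial. [folklore] -/
theorem exists_coeff_ne_zero_of_cpair_ne_zero {f g : MvPolynomial σ ℂ} (h : cpair f g ≠ 0) :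
    ∃ α : σ →₀ ℕ, coeff α f ≠ 0 ∧ coeff α g ≠ 0 := by
  obtain ⟨α, -, hα⟩ := Finset.exists_ne_zero_of_sum_ne_zero h
  exact ⟨α, left_ne_zero_of_mul hα, right_ne_zero_of_mul hα⟩

/-- Invariance under a simultaneous relabelling of the variables. [folklore] -/
theorem cpair_rename_rename {σ' : Type*} (e : σ ≃ σ') (f g : MvPolynomial σ ℂ) :
    cpair (rename e f) (rename e g) = cpair f g := by
  classical
  unfold cpair
  rw [support_rename_of_injective e.injective, Finset.sum_image fun α _ β _ h => Finsupp.mapDomain_injective e.injective h]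
  exact Finset.sum_congr rfl fun α _ => by rw [coeff_rename_mapDomain _ e.injective, coeff_rename_mapDomain _ e.injective]

/-- Adjoint form: `⟨e⁻¹·f, g⟩ = ⟨f, e·g⟩`. [folklore] -/
theorem cpair_rename_symm_left (e : σ ≃ σ) (f g : MvPolynomial σ ℂ) :
    cpair (rename e.symm f) g = cpair f (rename e g) := by
  rw [← cpair_rename_rename e (rename e.symm f) g, rename_rename, e.self_comp_symm, rename_id_apply]

end Pairing

/-! ## §2 The bridge: square-free coefficients of a weighted relabelling are pairings with products of fibre forms -/

section Bridge

variable {σ τ : Type*} [Fintype σ] [DecidableEq σ] [DecidableEq τ] (κ : σ → τ) (w : σ → ℂ)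

omit [Fintype σ] [DecidableEq σ] in
/-- `(κ_* β)(k) = ∑_{x ∈ supp β, κ x = k} β x`. [folklore] -/
theorem mapDomain_apply_eq_sum (β : σ →₀ ℕ) (k : τ) : Finsupp.mapDomain κ β k = ∑ x ∈ β.support with κ x = k, β x := by
  show (∑ x ∈ β.support, Finsupp.single (κ x) (β x)) k = _
  rw [Finsupp.finsetSum_apply, Finset.sum_filter]
  exact Finset.sum_congr rfl fun x _ => by rw [Finsupp.single_apply]

omit [Fintype σ] [DecidableEq σ] [DecidableEq τ] in
/-- The weighted relabelling `x ↦ w_x · z_{κ x}` on monomials: `x^β ↦ w^β z^{κ_* β}`. [folklore] -/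
theorem aeval_C_mul_X_monomial (β : σ →₀ ℕ) (a : ℂ) :
    aeval (fun x => C (w x) * X (κ x)) (monomial β a) =
      C (a * β.prod fun x n => w x ^ n) * monomial (Finsupp.mapDomain κ β) 1 := by
  have hX : (β.prod fun x n => (X (κ x) : MvPolynomial τ ℂ) ^ n) = monomial (Finsupp.mapDomain κ β) 1 := by
    rw [monomial_eq, C_1, one_mul,
      Finsupp.prod_mapDomain_index (h := fun k n => X k ^ n) (fun _ => pow_zero _) (fun _ _ _ => pow_add _ _ _)]
  rw [aeval_monomial, algebraMap_eq, ← hX, map_mul, mul_assoc]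
  congr 1
  simp only [Finsupp.prod]
  rw [map_prod, ← Finset.prod_mul_distrib]
  exact Finset.prod_congr rfl fun x _ => by rw [map_pow, mul_pow]

/-- CLOSED FORM: the coefficient of `x^β` in the product of the fibre forms over `μ'` is `[κ_* β = 𝟙_{μ'}] · w^β`. [folklore] -/
theorem coeff_prod_fibreForm (μ' : Finset τ) (β : σ →₀ ℕ) :
    coeff β (∏ k ∈ μ', ∑ x : σ, C (if κ x = k then w x else 0) * X x) =
      if Finsupp.mapDomain κ β = ∑ k ∈ μ', Finsupp.single k 1 then β.prod (fun x n => w x ^ n) else 0 := by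
  induction μ' using Finset.induction_on generalizing β with
  | empty =>
    rw [Finset.prod_empty, Finset.sum_empty, ← C_1, coeff_C]
    by_cases hβ : β = 0
    · subst hβ
      rw [if_pos rfl, Finsupp.mapDomain_zero, if_pos rfl, Finsupp.prod_zero_index]
    · have h2 : Finsupp.mapDomain κ β ≠ 0 := fun h0 => hβ (by
        rw [← Finsupp.degree_eq_zero_iff, ← Finsupp.degree_mapDomain κ β, h0, map_zero])
      rw [if_neg (Ne.symm hβ), if_neg h2]
  | insert k₀ S hk₀ ih =>
    rw [Finset.prod_insert hk₀, Finset.sum_insert hk₀]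
    set P := ∏ k ∈ S, ∑ x : σ, C (if κ x = k then w x else 0) * X x
    have hexp : coeff β ((∑ x : σ, C (if κ x = k₀ then w x else 0) * X x) * P) =
        ∑ x ∈ β.support with κ x = k₀, w x * coeff (β - Finsupp.single x 1) P := by
      rw [Finset.sum_mul, coeff_sum]
      have h1 : ∀ x : σ, coeff β (C (if κ x = k₀ then w x else 0) * X x * P) =
          if x ∈ β.support then (if κ x = k₀ then w x * coeff (β - Finsupp.single x 1) P else 0) else 0 := fun x => by
        rw [mul_assoc, coeff_C_mul, coeff_X_mul']
        split_ifs <;> simp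
      rw [Finset.sum_congr rfl fun x _ => h1 x, Finset.sum_ite_mem, Finset.univ_inter, Finset.sum_filter]
    have hG : ∀ x ∈ β.support.filter (fun x => κ x = k₀), w x * coeff (β - Finsupp.single x 1) P =
        if Finsupp.mapDomain κ β = Finsupp.single k₀ 1 + ∑ k ∈ S, Finsupp.single k 1 then β.prod (fun y n => w y ^ n) else 0 := by
      intro x hx
      obtain ⟨hxβ, hxk⟩ := Finset.mem_filter.1 hx
      have hle : Finsupp.single x 1 ≤ β := Finsupp.single_le_iff.2 (Nat.one_le_iff_ne_zero.2 (Finsupp.mem_support_iff.1 hxβ))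
      have hmap : Finsupp.mapDomain κ β = Finsupp.mapDomain κ (β - Finsupp.single x 1) + Finsupp.single k₀ 1 := by
        rw [show Finsupp.mapDomain κ β = Finsupp.mapDomain κ (β - Finsupp.single x 1 + Finsupp.single x 1) by
          rw [tsub_add_cancel_of_le hle], Finsupp.mapDomain_add, Finsupp.mapDomain_single, hxk]
      have hprod : β.prod (fun y n => w y ^ n) = (β - Finsupp.single x 1).prod (fun y n => w y ^ n) * w x := by
        rw [show β.prod (fun y n => w y ^ n) = (β - Finsupp.single x 1 + Finsupp.single x 1).prod (fun y n => w y ^ n) by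
          rw [tsub_add_cancel_of_le hle], Finsupp.prod_add_index' (h := fun y n => w y ^ n) (fun _ => pow_zero _)
          (fun _ _ _ => pow_add _ _ _), Finsupp.prod_single_index (h := fun y n => w y ^ n) (pow_zero _), pow_one]
      rw [ih, hmap, hprod]
      by_cases H : Finsupp.mapDomain κ (β - Finsupp.single x 1) = ∑ k ∈ S, Finsupp.single k 1
      · rw [if_pos H, if_pos (by rw [H, add_comm]), mul_comm]
      · rw [if_neg H, mul_zero, if_neg fun H' => H (add_right_cancel (H'.trans (add_comm _ _)))]
    rw [hexp, Finset.sum_congr rfl hG, Finset.sum_const, nsmul_eq_mul]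
    by_cases H : Finsupp.mapDomain κ β = Finsupp.single k₀ 1 + ∑ k ∈ S, Finsupp.single k 1
    · rw [if_pos H] -- `(κ_* β)(k₀) = 1`: exactly one variable of the fibre of `k₀` occurs in `β`, once
      have h0 : ∑ k ∈ S, (Finsupp.single k 1 : τ →₀ ℕ) k₀ = 0 :=
        Finset.sum_eq_zero fun k hk => by rw [Finsupp.single_apply, if_neg fun h : k = k₀ => hk₀ (h ▸ hk)]
      have hsum : ∑ x ∈ β.support with κ x = k₀, β x = 1 := by
        rw [← mapDomain_apply_eq_sum κ β k₀, H, Finsupp.add_apply, Finsupp.single_eq_same, Finsupp.finsetSum_apply, h0, add_zero]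
      have hcard : (β.support.filter fun x => κ x = k₀).card = 1 := by
        refine le_antisymm ?_ (Nat.one_le_iff_ne_zero.2 fun h0' => ?_)
        · calc (β.support.filter fun x => κ x = k₀).card = ∑ x ∈ β.support with κ x = k₀, 1 := Finset.card_eq_sum_ones _
            _ ≤ ∑ x ∈ β.support with κ x = k₀, β x := Finset.sum_le_sum fun x hx =>
                Nat.one_le_iff_ne_zero.2 (Finsupp.mem_support_iff.1 (Finset.mem_filter.1 hx).1)
            _ = 1 := hsum
        · rw [Finset.card_eq_zero.1 h0', Finset.sum_empty] at hsum
          exact zero_ne_one hsum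
      rw [hcard, Nat.cast_one, one_mul]
    · rw [if_neg H, mul_zero]

/-- ★ BRIDGE: `[z^{𝟙_{μ'}}] Φ_{κ,w}(f) = ⟨f, ∏_{k ∈ μ'} fibre form_k⟩` (the transpose of `Φ_{κ,w}` on `z^{𝟙_{μ'}}`). [folklore] -/
theorem coeff_indicator_aeval_eq_cpair (μ' : Finset τ) (f : MvPolynomial σ ℂ) :
    coeff (∑ k ∈ μ', Finsupp.single k 1) (aeval (fun x => C (w x) * X (κ x)) f) =
      cpair f (∏ k ∈ μ', ∑ x : σ, C (if κ x = k then w x else 0) * X x) := by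
  conv_lhs => rw [f.as_sum]
  rw [cpair_eq_sum_of_subset_left (subset_refl f.support), map_sum, coeff_sum]
  refine Finset.sum_congr rfl fun β _ => ?_
  rw [aeval_C_mul_X_monomial, coeff_C_mul, coeff_monomial, coeff_prod_fibreForm]
  by_cases H : Finsupp.mapDomain κ β = ∑ k ∈ μ', Finsupp.single k 1
  · rw [if_pos H, if_pos H, mul_one]
  · rw [if_neg H, if_neg H, mul_zero, mul_zero]

omit [Fintype σ] [DecidableEq σ] in
/-- Outside the ideal of squares `(z_k²)` some square-free coefficient `[z^{𝟙_{μ'}}]` is non-zero. [textbook] -/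
theorem exists_coeff_indicator_ne_zero {g : MvPolynomial τ ℂ}
    (hg : g ∉ Ideal.span (Set.range fun k : τ => (X k : MvPolynomial τ ℂ) ^ 2)) :
    ∃ μ' : Finset τ, coeff (∑ k ∈ μ', Finsupp.single k 1) g ≠ 0 := by
  refine not_forall_not.1 fun hall => hg ?_
  have hset : (Set.range fun k : τ => (X k : MvPolynomial τ ℂ) ^ 2) =
      (fun s => monomial s (1 : ℂ)) '' Set.range (fun k : τ => Finsupp.single k 2) := by
    rw [← Set.range_comp]
    exact congrArg Set.range (funext fun k => X_pow_eq_monomial)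
  rw [hset, mem_ideal_span_monomial_image]
  intro β hβ
  by_contra hno
  have hle1 : ∀ k, β k ≤ 1 := fun k => not_lt.1 fun hk => hno ⟨Finsupp.single k 2, ⟨k, rfl⟩, Finsupp.single_le_iff.2 hk⟩
  have hβeq : β = ∑ k ∈ β.support, Finsupp.single k 1 := Finsupp.ext fun k => by
    rw [Finsupp.finsetSum_apply]; simp_rw [Finsupp.single_apply]; rw [Finset.sum_ite_eq']
    split_ifs with hk
    exacts [le_antisymm (hle1 k) (Nat.one_le_iff_ne_zero.2 (Finsupp.mem_support_iff.1 hk)), Finsupp.notMem_support_iff.1 hk]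
  rw [hβeq] at hβ
  exact hall β.support (MvPolynomial.mem_support_iff.1 hβ)

/-- ★ EXISTENCE: outside `Φ_{κ,w}⁻¹((z_k²)_k)` some pairing with a product of distinct fibre forms is non-zero. [folklore] -/
theorem exists_cpair_prod_fibreForm_ne_zero {f : MvPolynomial σ ℂ}
    (hf : f ∉ Ideal.comap (aeval fun x => C (w x) * X (κ x) : MvPolynomial σ ℂ →ₐ[ℂ] MvPolynomial τ ℂ)
      (Ideal.span (Set.range fun k : τ => (X k : MvPolynomial τ ℂ) ^ 2))) :
    ∃ μ' : Finset τ, cpair f (∏ k ∈ μ', ∑ x : σ, C (if κ x = k then w x else 0) * X x) ≠ 0 := by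
  rw [Ideal.mem_comap] at hf
  obtain ⟨μ', hμ'⟩ := exists_coeff_indicator_ne_zero hf
  exact ⟨μ', by rwa [← coeff_indicator_aeval_eq_cpair]⟩

/-- … and the number of fibres is the degree of a homogeneous `f`. [folklore] -/
theorem card_eq_of_cpair_prod_fibreForm_ne_zero {d : ℕ} {f : MvPolynomial σ ℂ} (hf : f.IsHomogeneous d)
    {μ' : Finset τ} (h : cpair f (∏ k ∈ μ', ∑ x : σ, C (if κ x = k then w x else 0) * X x) ≠ 0) :
    μ'.card = d := by
  obtain ⟨α, hαf, hαu⟩ := exists_coeff_ne_zero_of_cpair_ne_zero h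
  rw [coeff_prod_fibreForm] at hαu
  have H : Finsupp.mapDomain κ α = ∑ k ∈ μ', Finsupp.single k 1 := not_not.1 fun H => hαu (if_neg H)
  have hdeg : α.degree = d := not_not.1 fun hne => hαf (hf.coeff_eq_zero hne)
  have h1 : (Finsupp.mapDomain κ α).degree = μ'.card := by
    rw [H, map_sum]
    simp_rw [Finsupp.degree_single]
    rw [Finset.sum_const, smul_eq_mul, mul_one]
  rw [Finsupp.degree_mapDomain, hdeg] at h1
  exact h1.symm

end Bridge

/-! ## §3 The block substitution is a weighted relabelling; its fibre forms are rank-one block forms -/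

section Block

variable {m p q : ℕ} (e : Fin m ≃ Fin p × Fin q) (ε : Fin q → ℂ) (δ : Fin p → ℂ)

/-- `blockSubst e ε δ` is the weighted relabelling `κ (a,b) = ((e a).1, (e b).2)`, `w (a,b) = ε (e a).2 δ (e b).1`. [this file] -/
theorem blockSubst_eq_aeval :
    blockSubst e ε δ = aeval (fun ab : Fin m × Fin m =>
      C ((fun ab : Fin m × Fin m => ε (e ab.1).2 * δ (e ab.2).1) ab) *
        X ((fun ab : Fin m × Fin m => ((e ab.1).1, (e ab.2).2)) ab)) := rfl

/-- The fibre form of the cell `k = (r, c)` is the rank-one form `ℓ(v_r, w_c)` of `EquivariantDialLayersApolarForms`,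
`v_r a = [(e a).1 = r] ε (e a).2`, `w_c b = [(e b).2 = c] δ (e b).1`. [this file] -/
theorem fibreForm_eq_linForm (k : Fin p × Fin q) :
    (∑ x : Fin m × Fin m, C (if ((e x.1).1, (e x.2).2) = k then ε (e x.1).2 * δ (e x.2).1 else 0) * X x) =
      ∑ x : Fin m × Fin m, C ((if (e x.1).1 = k.1 then ε (e x.1).2 else 0) *
        (if (e x.2).2 = k.2 then δ (e x.2).1 else 0)) * X x := by
  refine Finset.sum_congr rfl fun x _ => ?_
  obtain ⟨r, c⟩ := k
  by_cases h1 : (e x.1).1 = r <;> by_cases h2 : (e x.2).2 = c <;> simp [h1, h2]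

end Block

/-! ## §4 Symmetrisers: adjointness and the transfer to the test vector -/

section Transfer

variable {m : ℕ}

/-- ADJOINTNESS: `⟨∑_t c_t · t⁻¹ f, u⟩ = ⟨f, ∑_t c_t · t u⟩`. [folklore] -/
theorem cpair_sum_smul_rename_inv (c : Perm (Fin m) × Perm (Fin m) → ℂ) (f u : MvPolynomial (Fin m × Fin m) ℂ) :
    cpair (∑ t : Perm (Fin m) × Perm (Fin m), c t • rename (Equiv.prodCongr t.1⁻¹ t.2⁻¹) f) u =
      cpair f (∑ t : Perm (Fin m) × Perm (Fin m), c t • rename (Equiv.prodCongr t.1 t.2) u) := by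
  rw [cpair_sum_left, cpair_sum_smul_right]
  refine Finset.sum_congr rfl fun t _ => ?_
  rw [cpair_smul_left]
  exact congrArg (fun y => c t * y) (cpair_rename_symm_left (Equiv.prodCongr t.1 t.2) f u)

/-- A stable submodule carries a representation realising `t ↦ rename (t.1 × t.2)` (`…QuadricTypes` §4, packaged). [folklore] -/
theorem exists_representation_of_stable (W : Submodule ℂ (MvPolynomial (Fin m × Fin m) ℂ))
    (hW : ∀ (g : Perm (Fin m) × Perm (Fin m)) (w : MvPolynomial (Fin m × Fin m) ℂ),
      w ∈ W → rename (Equiv.prodCongr g.1 g.2) w ∈ W) :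
    ∃ ρ : Representation ℂ (Perm (Fin m) × Perm (Fin m)) W, ∀ (g : Perm (Fin m) × Perm (Fin m)) (x : W),
      ((ρ g x : W) : MvPolynomial (Fin m × Fin m) ℂ) = rename (Equiv.prodCongr g.1 g.2) (x : MvPolynomial _ ℂ) := by
  have hW' : ∀ (g : Perm (Fin m) × Perm (Fin m)) (w : MvPolynomial (Fin m × Fin m) ℂ),
      w ∈ W → (rename (Equiv.prodCongr g.1 g.2)).toLinearMap w ∈ W := fun g w hw => hW g w hw
  have hcomp : ∀ a b : Perm (Fin m) × Perm (Fin m), (⇑(Equiv.prodCongr a.1 a.2) ∘ ⇑(Equiv.prodCongr b.1 b.2) :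
      Fin m × Fin m → Fin m × Fin m) = ⇑(Equiv.prodCongr (a * b).1 (a * b).2) := fun a b => funext fun ⟨i, j⟩ => rfl
  have hid : (⇑(Equiv.prodCongr (1 : Perm (Fin m) × Perm (Fin m)).1 (1 : Perm (Fin m) × Perm (Fin m)).2) :
      Fin m × Fin m → Fin m × Fin m) = id := funext fun ⟨i, j⟩ => rfl
  exact
    ⟨{ toFun := fun g => ((rename (Equiv.prodCongr g.1 g.2)).toLinearMap).restrict (hW' g)
       map_one' := LinearMap.ext fun w => Subtype.ext (by
         simp only [LinearMap.coe_restrict_apply, AlgHom.toLinearMap_apply, Module.End.one_apply, hid, rename_id_apply])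
       map_mul' := fun a b => LinearMap.ext fun w => Subtype.ext (by
         simp only [LinearMap.coe_restrict_apply, AlgHom.toLinearMap_apply, Module.End.mul_apply, rename_rename, hcomp]) },
      fun _ _ => rfl⟩

/-- The span of the translates of one polynomial is stable. [folklore] -/
theorem rename_mem_span_translates (u : MvPolynomial (Fin m × Fin m) ℂ) (g : Perm (Fin m) × Perm (Fin m))
    {v : MvPolynomial (Fin m × Fin m) ℂ}
    (hv : v ∈ Submodule.span ℂ (Set.range fun t : Perm (Fin m) × Perm (Fin m) => rename (Equiv.prodCongr t.1 t.2) u)) :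
    rename (Equiv.prodCongr g.1 g.2) v ∈
      Submodule.span ℂ (Set.range fun t : Perm (Fin m) × Perm (Fin m) => rename (Equiv.prodCongr t.1 t.2) u) := by
  induction hv using Submodule.span_induction with
  | mem x hx =>
    obtain ⟨t, rfl⟩ := hx
    show rename (Equiv.prodCongr g.1 g.2) (rename (Equiv.prodCongr t.1 t.2) u) ∈ _
    have hcomp : (⇑(Equiv.prodCongr g.1 g.2) ∘ ⇑(Equiv.prodCongr t.1 t.2) : Fin m × Fin m → Fin m × Fin m) =
        ⇑(Equiv.prodCongr (g * t).1 (g * t).2) := funext fun ⟨i, j⟩ => rfl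
    rw [rename_rename, hcomp]
    exact Submodule.subset_span ⟨g * t, rfl⟩
  | zero => rw [map_zero]; exact Submodule.zero_mem _
  | add x y _ _ hx hy => rw [map_add]; exact Submodule.add_mem _ hx hy
  | smul a x _ hx => rw [smul_eq_C_mul, map_mul, rename_C, ← smul_eq_C_mul]; exact Submodule.smul_mem _ a hx

variable {W : Submodule ℂ (MvPolynomial (Fin m × Fin m) ℂ)} (ρ : Representation ℂ (Perm (Fin m) × Perm (Fin m)) W)
  (hρ : ∀ (g : Perm (Fin m) × Perm (Fin m)) (x : W),
    ((ρ g x : W) : MvPolynomial (Fin m × Fin m) ℂ) = rename (Equiv.prodCongr g.1 g.2) (x : MvPolynomial _ ℂ))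

include hρ in
/-- The isotypic projector of a relabelling representation, as a polynomial. [cite: SerreLinearRepresentations1977, §2.6 Thm. 8] -/
theorem coe_isotypicProj (χ : Perm (Fin m) × Perm (Fin m) → ℂ) (x : W) :
    ((isotypicProj ρ χ x : W) : MvPolynomial (Fin m × Fin m) ℂ) =
      ∑ t : Perm (Fin m) × Perm (Fin m), (χ 1 / Fintype.card (Perm (Fin m) × Perm (Fin m)) * χ t) •
        rename (Equiv.prodCongr t.1⁻¹ t.2⁻¹) (x : MvPolynomial (Fin m × Fin m) ℂ) := by
  rw [isotypicProj_apply, Submodule.coe_sum]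
  exact Finset.sum_congr rfl fun t _ => by simp only [Submodule.coe_smul, hρ, Prod.fst_inv, Prod.snd_inv]

include hρ in
/-- ★★ TRANSFER: if the `χ`-symmetrisation `∑_t χ(t) · t⁻¹ f` of a form pairs non-trivially with `u ∈ W`
(`χ` inversion-invariant, `χ(1) ≠ 0`), then `P_χ u ≠ 0` in `W`. [this file] -/
theorem isotypicProj_ne_zero_of_cpair_ne_zero {χ : Perm (Fin m) × Perm (Fin m) → ℂ} (hχinv : ∀ t, χ t⁻¹ = χ t)
    (hχ1 : χ 1 ≠ 0) {f u : MvPolynomial (Fin m × Fin m) ℂ} (hu : u ∈ W)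
    (h : cpair (∑ t : Perm (Fin m) × Perm (Fin m), χ t • rename (Equiv.prodCongr t.1⁻¹ t.2⁻¹) f) u ≠ 0) :
    isotypicProj ρ χ ⟨u, hu⟩ ≠ 0 := by
  intro h0
  have hval := congrArg Subtype.val h0
  rw [coe_isotypicProj ρ hρ, Submodule.coe_zero, sum_mul_smul_eq, smul_eq_zero] at hval
  have hC : χ 1 / (Fintype.card (Perm (Fin m) × Perm (Fin m)) : ℂ) ≠ 0 := div_ne_zero hχ1 (Nat.cast_ne_zero.2 Fintype.card_ne_zero)
  have hsum : ∑ t : Perm (Fin m) × Perm (Fin m), χ t • rename (Equiv.prodCongr t.1 t.2) u = 0 := by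
    rw [← hval.resolve_left hC]
    refine Fintype.sum_equiv (Equiv.inv (Perm (Fin m) × Perm (Fin m))) _ _ fun t => ?_
    simp only [Equiv.inv_apply, Prod.fst_inv, Prod.snd_inv, inv_inv, hχinv]
  exact h (by rw [cpair_sum_smul_rename_inv, hsum, cpair_zero_right])

/-- `χ^λ ⊠ χ^μ` is inversion-invariant. [folklore] -/
theorem boxProd_inv (la mu : Nat.Partition m) (t : Perm (Fin m) × Perm (Fin m)) :
    spechtCharacter ℂ la t⁻¹.1 * spechtCharacter ℂ mu t⁻¹.2 = spechtCharacter ℂ la t.1 * spechtCharacter ℂ mu t.2 := by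
  rw [Prod.fst_inv, Prod.snd_inv, Literature.RepresentationTheory.FiniteGroups.spechtCharacter_inv,
    Literature.RepresentationTheory.FiniteGroups.spechtCharacter_inv]

end Transfer

end Summit.ValiantsHypothesis.ValiantsHypothesis.Theorems.EquivariantDialLayersApolarPairing
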